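import Summits.ValiantsHypothesis.ValiantsHypothesis.Theses.SOSTau
import Summits.ValiantsHypothesis.ValiantsHypothesis.Theorems.SOSTauSameSignSquares

/-!
# ValiantsHypothesis / SOSTau — item `TwoSquares` (stmt-ValiantsHypothesis-18753)

A weighted sum of TWO sparse squares `a₁g₁² + a₂g₂²` has at most `4·(|supp g₁| + |supp g₂|)`
distinct real zeros: for weights of equal sign this is `SameSignSquares` (tree
`SOSTau.sameSignSquares_proof`, bound `2·Σ`); for opposite signs, `a g² - b h² = (√a g - √b h)(√a g + √b h)`
with `a, b > 0`, each factor has at most `|supp g| + |supp h|` monomials, hence at most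
`2(|supp g| + |supp h|)` distinct real zeros (sparse Descartes,
`Literature.Computability.AlgebraicComplexity.card_roots_toFinset_le_of_card_support`).
HONEST FRAMING: the calibration rung of a dormant route (Dutta 2021 Thm 9 shape); nothing here
bears on `VP ≠ VNP`.
-/

-- layout Summits/ValiantsHypothesis/ValiantsHypothesis forces the duplicated namespace component
set_option linter.dupNamespace false

namespace Summit.ValiantsHypothesis.ValiantsHypothesis.Theorems.SOSTau

open Polynomial Finset

/-- A nonzero linear combination `C u * g + C w * h` has at most `2(|supp g| + |supp h|)` distinct
real zeros. [folklore] -/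
theorem card_roots_C_mul_add_C_mul_le (u w : ℝ) (g h : ℝ[X]) (hF : C u * g + C w * h ≠ 0) :
    (C u * g + C w * h).roots.toFinset.card ≤ 2 * (g.support.card + h.support.card) := by
  have hsupp : (C u * g + C w * h).support.card ≤ g.support.card + h.support.card := by
    calc (C u * g + C w * h).support.card ≤ ((C u * g).support ∪ (C w * h).support).card :=
          card_le_card support_add
      _ ≤ (C u * g).support.card + (C w * h).support.card := card_union_le _ _
      _ ≤ g.support.card + h.support.card := by
          refine Nat.add_le_add ?_ ?_
          · rw [← smul_eq_C_mul]; exact card_le_card (support_smul u g)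
          · rw [← smul_eq_C_mul]; exact card_le_card (support_smul w h)
  have hpos : 0 < (C u * g + C w * h).support.card :=
    Finset.card_pos.2 (Polynomial.support_nonempty.2 hF)
  calc (C u * g + C w * h).roots.toFinset.card
      ≤ 2 * ((C u * g + C w * h).support.card - 1) + 1 :=
        Literature.Computability.AlgebraicComplexity.card_roots_toFinset_le_of_card_support hF
    _ ≤ 2 * (g.support.card + h.support.card) := by omega

/-- Opposite signs: `a > 0 > b`. [folklore] -/
theorem card_roots_two_squares_of_pos_of_neg (a b : ℝ) (g h : ℝ[X]) (ha : 0 < a) (hb : b < 0) :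
    (C a * g ^ 2 + C b * h ^ 2).roots.toFinset.card ≤ 4 * (g.support.card + h.support.card) := by
  classical
  set u := Real.sqrt a with hu
  set w := Real.sqrt (-b) with hw
  have hua : u * u = a := Real.mul_self_sqrt ha.le
  have hwb : w * w = -b := Real.mul_self_sqrt (by linarith)
  have hfac : C a * g ^ 2 + C b * h ^ 2 = (C u * g + C (-w) * h) * (C u * g + C w * h) := by
    rw [← hua, show b = -(w * w) by linarith, C_mul, map_neg, map_neg, C_mul]
    ring
  by_cases hP : C a * g ^ 2 + C b * h ^ 2 = 0
  · rw [hP, roots_zero, Multiset.toFinset_zero, card_empty]; exact Nat.zero_le _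
  rw [hfac] at hP ⊢
  have hF₁ : C u * g + C (-w) * h ≠ 0 := fun h0 => hP (by rw [h0, zero_mul])
  have hF₂ : C u * g + C w * h ≠ 0 := fun h0 => hP (by rw [h0, mul_zero])
  rw [roots_mul hP, Multiset.toFinset_add]
  calc ((C u * g + C (-w) * h).roots.toFinset ∪ (C u * g + C w * h).roots.toFinset).card
      ≤ (C u * g + C (-w) * h).roots.toFinset.card + (C u * g + C w * h).roots.toFinset.card :=
        card_union_le _ _
    _ ≤ 2 * (g.support.card + h.support.card) + 2 * (g.support.card + h.support.card) :=
        Nat.add_le_add (card_roots_C_mul_add_C_mul_le u (-w) g h hF₁)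
          (card_roots_C_mul_add_C_mul_le u w g h hF₂)
    _ = 4 * (g.support.card + h.support.card) := by ring

/-- Equal signs (both `≥ 0`), from `SameSignSquares`. [folklore] -/
theorem card_roots_two_squares_of_nonneg (a b : ℝ) (g h : ℝ[X]) (ha : 0 ≤ a) (hb : 0 ≤ b) :
    (C a * g ^ 2 + C b * h ^ 2).roots.toFinset.card ≤ 2 * (g.support.card + h.support.card) := by
  have hS := sameSignSquares_proof
  unfold Theses.SOSTau.SameSignSquares at hS
  have h2 := hS 2 ![a, b] ![g, h] (fun i => by fin_cases i <;> simpa)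
  simp only [Fin.sum_univ_two, Matrix.cons_val_zero, Matrix.cons_val_one] at h2
  exact h2

/-- **Item `TwoSquares` (stmt-ValiantsHypothesis-18753)**, with `c = 4`. [folklore] -/
theorem twoSquares_proof : Theses.SOSTau.TwoSquares := by
  unfold Theses.SOSTau.TwoSquares
  refine ⟨4, fun a₁ a₂ g₁ g₂ => ?_⟩
  rcases le_or_gt 0 a₁ with h1 | h1 <;> rcases le_or_gt 0 a₂ with h2 | h2
  · exact (card_roots_two_squares_of_nonneg a₁ a₂ g₁ g₂ h1 h2).trans (by omega)
  · rcases h1.eq_or_lt with h0 | h1'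
    · -- `a₁ = 0`, `a₂ < 0`: negate
      have hneg : C a₁ * g₁ ^ 2 + C a₂ * g₂ ^ 2 = -(C (-a₁) * g₁ ^ 2 + C (-a₂) * g₂ ^ 2) := by
        rw [map_neg, map_neg]; ring
      rw [hneg, roots_neg]
      exact (card_roots_two_squares_of_nonneg (-a₁) (-a₂) g₁ g₂ (by linarith) (by linarith)).trans
        (by omega)
    · exact card_roots_two_squares_of_pos_of_neg a₁ a₂ g₁ g₂ h1' h2
  · rcases h2.eq_or_lt with h0 | h2'
    · have hneg : C a₁ * g₁ ^ 2 + C a₂ * g₂ ^ 2 = -(C (-a₁) * g₁ ^ 2 + C (-a₂) * g₂ ^ 2) := by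
        rw [map_neg, map_neg]; ring
      rw [hneg, roots_neg]
      exact (card_roots_two_squares_of_nonneg (-a₁) (-a₂) g₁ g₂ (by linarith) (by linarith)).trans
        (by omega)
    · rw [add_comm (C a₁ * g₁ ^ 2), add_comm g₁.support.card]
      exact card_roots_two_squares_of_pos_of_neg a₂ a₁ g₂ g₁ h2' h1
  · have hneg : C a₁ * g₁ ^ 2 + C a₂ * g₂ ^ 2 = -(C (-a₁) * g₁ ^ 2 + C (-a₂) * g₂ ^ 2) := by
      rw [map_neg, map_neg]; ring
    rw [hneg, roots_neg]
    exact (card_roots_two_squares_of_nonneg (-a₁) (-a₂) g₁ g₂ (by linarith) (by linarith)).trans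
      (by omega)

end Summit.ValiantsHypothesis.ValiantsHypothesis.Theorems.SOSTau
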